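import Literature.Analysis.OperatorTheory.Enflo2023.StepRealisation
import Literature.Analysis.OperatorTheory.Enflo2023.ClaimRun
import HarnessLib

/-!
# Enflo (2023), v2 pp.16–20: the run-restricted residual reduced to first-order independence (34)

P. H. Enflo, *On the invariant subspace problem in Hilbert spaces*, arXiv:2305.15442v2 (2023) — a CLAIMED result
under adjudication; nothing here asserts the manuscript's theorem.

`StepRealisation` proves, kernel-tight and WITH REMAINDERS, that the text's independence hypothesis at a state gives
ONE constrained Main-Construction step landing in a TRUE MC state.  This module iterates that along THE RUN of the
endgame (`MCStep.ClaimRun`, `MCStep.nis_of_claimRun`):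

* FAITHFUL FORM (§2). `IndepRun₂ T x₀ S ι σ β s₀` — (34) for the TWO TARGETED functionals (side condition (46) and
  decrease (b′)) asked, with ONE constant `σ`, at every state reachable from `s₀` under the radius invariant `RadInv`
  that lies in the epoch invariant of a reachable pivot `P`, for the side-condition vector `c = x₀ − v_P` — gives
  `ClaimRun T x₀ S (22/σ) β 0 (RadInv σ s₀) s₀` for every `0 ≤ β ≤ σ²/1000` provided the start radius has the margin
  `(22/σ + 1)(εθ)₀` (`claimRun_of_indepRun₂`; the drift constant `22/σ` and the radius bookkeeping come from
  `exists_step₂`: (45) is a CONSEQUENCE of the step), hence a non-trivial closed invariant subspace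
  (`nis_of_indepRun₂`), and the packaged residual `PartBResidualIndep₂ → Referee.ISP_separable`.
* THREE-FOLD FORM (§1) — A RECORDED WRONG TURN. `IndepRun` asks the three-fold independence `IndepAt` (drift targeted
  too) at the pivots themselves with `c = x₀ − v_P`; by `StepRealisation.not_indepBr_self` this is impossible as soon
  as `(εθ)₀ > 0` (`not_indepRun`), so `IndepRun`/`PartBResidualIndep` are VACUOUS residuals (true only through
  `(εθ) = 0`, where an invariant subspace is immediate).  They are kept, so that the record shows exactly why the
  drift cannot be a free target, together with the (valid but vacuous-in-use) implications.

What is NOT a theorem here: `IndepRun₂` for any operator without invariant subspaces — it is v2's (34) ("we assume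
first that … for some s > 0", p.16, and "we can assume that for all n, y_n will be δ₂-linearly independent",
p.19–20) transported along the run with a uniform modulus; the text gives no argument for uniformity (it cites
Beauzamy/Enflo 1985 for the DEGENERATE case only).  See `pub-enflo/GAP.md` §"Formaliser 2, generation 11".
-/

noncomputable section

open scoped InnerProductSpace ComplexConjugate NNReal
open ContinuousLinearMap RCLike Metric Set

namespace Literature.Analysis.OperatorTheory.Enflo2023

namespace StepRealisation

open MCStep

variable {E H : Type*} [NormedAddCommGroup E] [InnerProductSpace ℂ E] [CompleteSpace E]
  [NormedAddCommGroup H] [InnerProductSpace ℂ H] [CompleteSpace H]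
variable {P : Type*} [NormedAddCommGroup P] [NormedSpace ℝ P]

omit [CompleteSpace E] [CompleteSpace H] in
/-- At a true MC state the moved vector `x₀ − v` is non-zero (`‖v‖ = ε ≤ 0.7 < 1 = ‖x₀‖`). [cite: Enflo2023, v2 p.2, p.17] -/
lemma x₀_sub_v_ne_zero {T : H →L[ℂ] H} {x₀ : H} {S : E →L[ℂ] E} (hx₀ : ‖x₀‖ = 1) (s : State T x₀ S) :
    x₀ - s.v ≠ 0 := by
  intro h
  have h1 : x₀ = s.v := sub_eq_zero.1 h
  have h2 := s.norm_v hx₀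
  rw [← h1, hx₀] at h2
  linarith [s.hε.2]

/-! ### 1. The three-fold form at the pivots — recorded as VACUOUS -/

/-- THREE-FOLD RUN HYPOTHESIS (drift targeted too), asked at every reachable pivot `P` and every reachable state in
its epoch invariant for `c = x₀ − v_P`.  VACUOUS unless `(εθ)₀ = 0`: see `not_indepRun`.  Kept as the record of why
(45) cannot be a target. [cite: Enflo2023, v2 (34) p.16; p.19–20] -/
def IndepRun (T : H →L[ℂ] H) (x₀ : H) (S : E →L[ℂ] E) (ι : P →+ (E →L[ℂ] E)) (σ β : ℝ)
    (s₀ : State T x₀ S) : Prop :=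
  ∀ Pv s : State T x₀ S, ReachN 1 β (fun _ => True) s₀ Pv → ReachN 1 β (fun _ => True) s₀ s →
    InvP 1 Pv (x₀ - Pv.v) s → 0 < s.etheta → IndepAt ι σ s (x₀ - Pv.v)

omit [NormedSpace ℝ P] in
/-- THE THREE-FOLD RUN HYPOTHESIS IS VACUOUS: at the start state taken as its own pivot (`P = s = s₀`, which is in
its own epoch invariant) it asks `IndepBr (Wn s₀) x₀ (x₀ − v₀) ι σ` with `v₀ =` the bracket point — impossible by
`not_indepBr_self` (decrement = 2Re(side) − drift to first order).  So `IndepRun … s₀` forces `(εθ)₀ = 0`.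
[folklore] -/
theorem not_indepRun {T : H →L[ℂ] H} {x₀ : H} (hx₀ : ‖x₀‖ = 1) {S : E →L[ℂ] E} {ι : P →+ (E →L[ℂ] E)}
    {σ β : ℝ} (s₀ : State T x₀ S) (he : 0 < s₀.etheta) : ¬ IndepRun T x₀ S ι σ β s₀ := by
  intro h
  have hinv : InvP 1 s₀ (x₀ - s₀.v) s₀ := by
    refine ⟨le_rfl, ?_, ?_⟩
    · rw [sub_self, inner_zero_right]
    · rw [sub_self, inner_zero_right, map_zero, abs_zero, sub_self, mul_zero]
  have hind : IndepBr (Wn s₀) x₀ (x₀ - s₀.v) ι σ := h s₀ s₀ ReachN.start ReachN.start hinv he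
  have hvz : s₀.v = bz (Wn s₀) x₀ := (isBracket_Wn hx₀ s₀ he).unique (isBracket_bz (Wn s₀) x₀)
  rw [hvz] at hind
  exact not_indepBr_self (Wn s₀) x₀ ι σ hind

/-- (valid, but vacuous in use — see `not_indepRun`) the three-fold run hypothesis gives the run-restricted residual
with `C = 1`, angle `0`, no invariant. [cite: Enflo2023, v2 (34)–(46), p.16–19; p.19–20] -/
theorem claimRun_of_indepRun [CompleteSpace P] {T : H →L[ℂ] H} {x₀ : H} (hx₀ : ‖x₀‖ = 1) {S : E →L[ℂ] E}
    (hS : ‖S‖ ≤ 1) {ι : P →+ (E →L[ℂ] E)} (hιs : ∀ (t : ℝ) (p : P), ι (t • p) = (t : ℂ) • ι p)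
    (hι1 : ∀ p, ‖ι p‖ ≤ ‖p‖) (hιS : ∀ p, ι p ∘L S = S ∘L ι p) {σ β : ℝ} (hσ : 0 < σ) (hσ1 : σ ≤ 1)
    (hβ0 : 0 ≤ β) (hβ : β ≤ σ ^ 2 / 1000) (G : ℝ → ℝ) (hG0 : ∀ x, 0 ≤ G x) (s₀ : State T x₀ S)
    (h : IndepRun T x₀ S ι σ β s₀) : ClaimRun T x₀ S 1 β G (fun _ => True) s₀ := by
  intro Pv hPv
  refine ⟨x₀ - Pv.v, x₀_sub_v_ne_zero hx₀ Pv, ?_, fun s hs hinv => ?_⟩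
  · rw [sub_self, norm_zero]
    exact mul_nonneg (hG0 _) (by positivity)
  · rcases (s.etheta_nonneg hx₀ hS).eq_or_lt with he | he
    · refine ⟨s, trivial, ?_, ?_, ?_⟩
      · rw [← he]; simp
      · rw [sub_self, inner_zero_right]
      · rw [sub_self, inner_zero_right, map_zero, abs_zero, ← he]; simp
    · obtain ⟨s', h1, h2, h3, -, -⟩ :=
        exists_state_step hιs hι1 hιS hx₀ s he hσ hσ1 hβ0 hβ (x₀ - Pv.v) (h Pv s hPv hs hinv he)
      refine ⟨s', trivial, h1.le, h2, ?_⟩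
      rw [RCLike.re_to_complex, h3, abs_neg, abs_of_nonneg (by positivity), one_mul]

/-- THREE-FOLD PACKAGED RESIDUAL — VACUOUS in its second disjunct unless `(εθ)₀ = 0` (`not_indepRun`); kept for the
record, superseded by `PartBResidualIndep₂`. [cite: Enflo2023, v2 (34) p.16, p.19–20; §Theorem p.20–22] -/
@[claim "Enflo2023" "disputed"]
def PartBResidualIndep : Prop :=
  ∀ (H : Type) [NormedAddCommGroup H] [InnerProductSpace ℂ H] [CompleteSpace H]
    [TopologicalSpace.SeparableSpace H], ¬ FiniteDimensional ℂ H →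
    ∀ (T : H →L[ℂ] H), ‖T‖ < 1 → ‖T‖ = 1e-20 →
      HasNontrivialClosedInvariantSubspace T ∨
      ∃ (x₀ : H) (s₀ : State T x₀ Vy.S) (σ : ℝ), ‖x₀‖ = 1 ∧ 0 < σ ∧ σ ≤ 1 ∧
        IndepRun T x₀ Vy.S (ιS Vy.S) σ (σ ^ 2 / 1000) s₀

/-! ### 2. The faithful form: two targeted functionals, drift bounded, radius invariant -/

/-- The commutant `{S}'` as a real normed space — an EXPLICIT instance: on `ℓ²` the two `ℝ`-module structures of
`ℓ² →L[ℂ] ℓ²` (restriction of scalars from `ℂ` vs. the coordinatewise one of `lp`) are not reducibly equal, so the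
generic `Submodule.normedSpace` is not found for `Comm Vy.S` by instance search; this pins the one `Comm` was built
with. [folklore] -/
instance normedSpace_comm (S : E →L[ℂ] E) : NormedSpace ℝ (Comm S) := Submodule.normedSpace _


/-- THE RADIUS INVARIANT of the run: `ε²` has moved by at most `(22/σ + 1)((εθ)₀ − (εθ)_s)` — the per-step radius
change `(22/σ + 1)β(εθ)` of `exists_step₂` telescoped along (b′) (v2 (32): "‖[ ]⁻¹x₀‖ does not tend to 0 or to 1").
[cite: Enflo2023, v2 (32) p.15, (45) p.19] -/
def RadInv {T : H →L[ℂ] H} {x₀ : H} {S : E →L[ℂ] E} (σ : ℝ) (s₀ s : State T x₀ S) : Prop :=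
  |s.ε ^ 2 - s₀.ε ^ 2| ≤ (22 / σ + 1) * (s₀.etheta - s.etheta)

/-- THE RUN-LEVEL HYPOTHESIS, FAITHFUL FORM — the honest residual this route reaches: the two-fold first-order
independence (34) `IndepAt₂ ι σ s c` with ONE constant `σ`, at every state `s` with `(εθ)_s > 0` reachable from `s₀`
(drift constant `22/σ`, ratio `β`, radius invariant `RadInv σ s₀`) that lies in the epoch invariant of a reachable
pivot `P`, for `c = x₀ − v_P` ("we can assume that for all `n`, `y_n` will be `δ₂`-linearly independent", v2 p.19
l.667–677 — asserted in the text, never derived). [cite: Enflo2023, v2 (34) p.16; p.19–20] -/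
def IndepRun₂ (T : H →L[ℂ] H) (x₀ : H) (S : E →L[ℂ] E) (ι : P →+ (E →L[ℂ] E)) (σ β : ℝ)
    (s₀ : State T x₀ S) : Prop :=
  ∀ Pv s : State T x₀ S, ReachN (22 / σ) β (RadInv σ s₀) s₀ Pv → ReachN (22 / σ) β (RadInv σ s₀) s₀ s →
    InvP (22 / σ) Pv (x₀ - Pv.v) s → 0 < s.etheta → IndepAt₂ ι σ s (x₀ - Pv.v)

/-- **Run-level independence ⟹ the run-restricted residual** with `C = 22/σ`, angle function `G` arbitrary `≥ 0`
(the side-condition vector is `x₀ − v_P` itself, angle `0`) and the radius invariant, PROVIDED the start radius has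
the margin `(22/σ + 1)(εθ)₀` in `ε²` inside `[0.09, 0.49]`: each step is `exists_state_step₂` — side condition and
decrement EXACT with remainders, drift bounded — and the margin at the current state follows from the invariant by
telescoping. [cite: Enflo2023, v2 (32), (34)–(46), p.15–19; p.19–20] -/
theorem claimRun_of_indepRun₂ [CompleteSpace P] {T : H →L[ℂ] H} {x₀ : H} (hx₀ : ‖x₀‖ = 1) {S : E →L[ℂ] E}
    (hS : ‖S‖ ≤ 1) {ι : P →+ (E →L[ℂ] E)} (hιs : ∀ (t : ℝ) (p : P), ι (t • p) = (t : ℂ) • ι p)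
    (hι1 : ∀ p, ‖ι p‖ ≤ ‖p‖) (hιS : ∀ p, ι p ∘L S = S ∘L ι p) {σ β : ℝ} (hσ : 0 < σ) (hσ1 : σ ≤ 1)
    (hβ0 : 0 ≤ β) (hβ : β ≤ σ ^ 2 / 1000) (G : ℝ → ℝ) (hG0 : ∀ x, 0 ≤ G x) (s₀ : State T x₀ S)
    (hstart : (0.09 : ℝ) + (22 / σ + 1) * s₀.etheta ≤ s₀.ε ^ 2 ∧
      s₀.ε ^ 2 + (22 / σ + 1) * s₀.etheta ≤ 0.49)
    (h : IndepRun₂ T x₀ S ι σ β s₀) : ClaimRun T x₀ S (22 / σ) β G (RadInv σ s₀) s₀ := by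
  have hσ2 : σ ^ 2 ≤ σ := by nlinarith
  have hβ1 : β ≤ 1 := by linarith
  intro Pv hPv
  refine ⟨x₀ - Pv.v, x₀_sub_v_ne_zero hx₀ Pv, ?_, fun s hs hinv => ?_⟩
  · rw [sub_self, norm_zero]
    exact mul_nonneg (hG0 _) (by positivity)
  · set K : ℝ := 22 / σ + 1 with hK
    have hK0 : 0 ≤ K := by positivity
    have hR0 : RadInv σ s₀ s₀ := by
      show |s₀.ε ^ 2 - s₀.ε ^ 2| ≤ (22 / σ + 1) * (s₀.etheta - s₀.etheta)
      rw [sub_self, abs_zero, sub_self, mul_zero]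
    have hRs : |s.ε ^ 2 - s₀.ε ^ 2| ≤ K * (s₀.etheta - s.etheta) := hs.inv hR0
    have he0 : 0 ≤ s.etheta := s.etheta_nonneg hx₀ hS
    rcases he0.eq_or_lt with he | he
    · refine ⟨s, hs.inv hR0, ?_, ?_, ?_⟩
      · rw [← he]; simp
      · rw [sub_self, inner_zero_right]
      · rw [sub_self, inner_zero_right, map_zero, abs_zero, ← he]; simp
    · have hβe : K * β * s.etheta ≤ K * s.etheta := by
        have h1 : β * s.etheta ≤ s.etheta := mul_le_of_le_one_left he0 hβ1
        have h2 := mul_le_mul_of_nonneg_left h1 hK0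
        linarith [h2]
      have hab := abs_le.1 hRs
      have hlo : (0.09 : ℝ) + (22 / σ + 1) * β * s.etheta ≤ s.ε ^ 2 := by
        rw [← hK]; linarith [hab.1, hstart.1]
      have hhi : s.ε ^ 2 + (22 / σ + 1) * β * s.etheta ≤ 0.49 := by
        rw [← hK]; linarith [hab.2, hstart.2]
      obtain ⟨s', h1, h2, h3, h4, -⟩ := exists_state_step₂ hιs hι1 hιS hx₀ s he hσ hσ1 hβ0 hβ (x₀ - Pv.v)
        (h Pv s hPv hs hinv he) hlo hhi
      refine ⟨s', ?_, h1.le, h2, ?_⟩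
      · show |s'.ε ^ 2 - s₀.ε ^ 2| ≤ (22 / σ + 1) * (s₀.etheta - s'.etheta)
        rw [← hK] at h4 ⊢
        calc |s'.ε ^ 2 - s₀.ε ^ 2| ≤ |s'.ε ^ 2 - s.ε ^ 2| + |s.ε ^ 2 - s₀.ε ^ 2| := abs_sub_le _ _ _
          _ ≤ K * β * s.etheta + K * (s₀.etheta - s.etheta) := add_le_add h4 hRs
          _ = K * (s₀.etheta - s'.etheta) := by rw [h1]; ring
      · rw [RCLike.re_to_complex]
        exact h3

/-- **Run-level two-fold independence ⟹ a non-trivial closed invariant subspace** (`‖x₀‖ = 1`, `‖S‖ ≤ 1`,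
`0 < σ ≤ 1`, start margin; `β := σ²/1000`; `MCStep.nis_of_claimRun` with `C = 22/σ`, `G = 0`, `N = RadInv σ s₀`).
[cite: Enflo2023, v2 (34)–(47), p.16–20; p.22 (11)] -/
theorem nis_of_indepRun₂ [CompleteSpace P] (T : H →L[ℂ] H) (x₀ : H) (hx₀ : ‖x₀‖ = 1) (S : E →L[ℂ] E)
    (hS : ‖S‖ ≤ 1) {ι : P →+ (E →L[ℂ] E)} (hιs : ∀ (t : ℝ) (p : P), ι (t • p) = (t : ℂ) • ι p)
    (hι1 : ∀ p, ‖ι p‖ ≤ ‖p‖) (hιS : ∀ p, ι p ∘L S = S ∘L ι p) {σ : ℝ} (hσ : 0 < σ) (hσ1 : σ ≤ 1)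
    (s₀ : State T x₀ S)
    (hstart : (0.09 : ℝ) + (22 / σ + 1) * s₀.etheta ≤ s₀.ε ^ 2 ∧
      s₀.ε ^ 2 + (22 / σ + 1) * s₀.etheta ≤ 0.49)
    (h : IndepRun₂ T x₀ S ι σ (σ ^ 2 / 1000) s₀) :
    HasNontrivialClosedInvariantSubspace T := by
  have hβ : 0 < σ ^ 2 / 1000 := by positivity
  have hσ2 : σ ^ 2 ≤ 1 := pow_le_one₀ hσ.le hσ1
  have hβ1 : σ ^ 2 / 1000 ≤ 1 := by linarith
  have hC : (0 : ℝ) ≤ 22 / σ := by positivity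
  exact nis_of_claimRun T x₀ hx₀ S hS hC hβ hβ1 (fun _ => 0) (fun _ => le_rfl)
    (fun η hη => ⟨1, one_pos, fun _ _ _ => hη.le⟩) s₀
    (claimRun_of_indepRun₂ hx₀ hS hιs hι1 hιS hσ hσ1 hβ.le le_rfl (fun _ => 0) (fun _ => le_rfl) s₀ hstart h)

/-- **THE PACKAGED RESIDUAL OF PART B IN THE FORM THIS ROUTE REACHES (faithful form)** — a HYPOTHESIS, never a
theorem: for every operator of the reduced class (`‖T‖ = 10⁻²⁰` after `wlog_opNorm`, `H` separable
infinite-dimensional) EITHER a non-trivial closed invariant subspace is at hand, OR there are a unit vector `x₀`, a true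
MC state `s₀` over the shift of `ℓ²` whose radius has the margin `(22/σ + 1)(εθ)₀`, and a constant `0 < σ ≤ 1` such
that the two-fold first-order independence (34) holds with modulus `σ` along the run from `s₀` over the commutant of
the shift (`IndepRun₂`).  This is (34) + "we can assume that for all `n` … `δ₂`-linearly independent" (v2 p.16,
p.19–20) and NOTHING ELSE of pp.16–20: the step itself ((36)–(46) with remainders) is now a theorem
(`StepRealisation.exists_state_step₂`). [cite: Enflo2023, v2 (34) p.16, p.19–20; §Theorem p.20–22] -/
@[claim "Enflo2023" "disputed"]
def PartBResidualIndep₂ : Prop :=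
  ∀ (H : Type) [NormedAddCommGroup H] [InnerProductSpace ℂ H] [CompleteSpace H]
    [TopologicalSpace.SeparableSpace H], ¬ FiniteDimensional ℂ H →
    ∀ (T : H →L[ℂ] H), ‖T‖ < 1 → ‖T‖ = 1e-20 →
      HasNontrivialClosedInvariantSubspace T ∨
      ∃ (x₀ : H) (s₀ : State T x₀ Vy.S) (σ : ℝ), ‖x₀‖ = 1 ∧ 0 < σ ∧ σ ≤ 1 ∧
        ((0.09 : ℝ) + (22 / σ + 1) * s₀.etheta ≤ s₀.ε ^ 2 ∧ s₀.ε ^ 2 + (22 / σ + 1) * s₀.etheta ≤ 0.49) ∧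
        IndepRun₂ T x₀ Vy.S (ιS Vy.S) σ (σ ^ 2 / 1000) s₀

/-- **The implication that IS a theorem (faithful form)**: `PartBResidualIndep₂ → ISP_separable` (`T = 0` by
`nis_zero`; otherwise rescale by `wlog_opNorm`, and in the second case run `nis_of_indepRun₂` over the commutant of the
shift, `ιS_props`). [cite: Enflo2023, v2 §Theorem p.20–22; (34) p.16] -/
theorem isp_of_partBResidualIndep₂ (hR : PartBResidualIndep₂) : Referee.ISP_separable := by
  intro H _ _ _ _ hH T
  by_cases hT0 : T = 0
  · rw [hT0]; exact EndToEnd.nis_zero hH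
  · obtain ⟨hnorm, hiff⟩ := wlog_opNorm T hT0
    set T' : H →L[ℂ] H := (((1e-20 : ℝ) / ‖T‖ : ℝ) : ℂ) • T
    have hT1 : ‖T'‖ < 1 := by rw [hnorm]; norm_num
    rcases hR H hH T' hT1 hnorm with hinv | ⟨x₀, s₀, σ, hx₀, hσ, hσ1, hstart, hrun⟩
    · exact hiff.1 hinv
    · obtain ⟨hιs, hι1, hιS⟩ := ιS_props (Vy.S)
      exact hiff.1 (nis_of_indepRun₂ T' x₀ hx₀ Vy.S Vy.norm_S_le hιs hι1 hιS hσ hσ1 s₀ hstart hrun)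

/-- (three-fold, vacuous in use) `PartBResidualIndep → ISP_separable`. [cite: Enflo2023, v2 §Theorem p.20–22] -/
theorem isp_of_partBResidualIndep (hR : PartBResidualIndep) : Referee.ISP_separable := by
  intro H _ _ _ _ hH T
  by_cases hT0 : T = 0
  · rw [hT0]; exact EndToEnd.nis_zero hH
  · obtain ⟨hnorm, hiff⟩ := wlog_opNorm T hT0
    set T' : H →L[ℂ] H := (((1e-20 : ℝ) / ‖T‖ : ℝ) : ℂ) • T
    have hT1 : ‖T'‖ < 1 := by rw [hnorm]; norm_num
    have hβ : ∀ σ : ℝ, 0 < σ → σ ≤ 1 → (0 : ℝ) < σ ^ 2 / 1000 ∧ σ ^ 2 / 1000 ≤ 1 := fun σ hσ hσ1 =>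
      ⟨by positivity, by nlinarith⟩
    rcases hR H hH T' hT1 hnorm with hinv | ⟨x₀, s₀, σ, hx₀, hσ, hσ1, hrun⟩
    · exact hiff.1 hinv
    · obtain ⟨hιs, hι1, hιS⟩ := ιS_props (Vy.S)
      exact hiff.1 (nis_of_claimRun T' x₀ hx₀ Vy.S Vy.norm_S_le zero_le_one (hβ σ hσ hσ1).1 (hβ σ hσ hσ1).2
        (fun _ => 0) (fun _ => le_rfl) (fun η hη => ⟨1, one_pos, fun _ _ _ => hη.le⟩) s₀
        (claimRun_of_indepRun hx₀ Vy.norm_S_le hιs hι1 hιS hσ hσ1 (hβ σ hσ hσ1).1.le le_rfl (fun _ => 0)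
          (fun _ => le_rfl) s₀ hrun))

/-- Calibration: independence (either form) is SUFFICIENT, not necessary — at `T = 0` the run-restricted residual
holds (`MCStep.claimRun_top_zero`) although first-order independence fails for the rank-one normalised operator
(`StepRealisation.not_indepBr_zero`: it fails already for `W = 0`). [folklore] -/
theorem indep_sufficient_not_necessary (x₀ c : H) (σ : ℝ) :
    ¬ IndepBr (0 : Vy.ℓ2 →L[ℂ] H) x₀ c (ιS Vy.S) σ :=
  not_indepBr_zero x₀ c _ σ

end StepRealisation

end Literature.Analysis.OperatorTheory.Enflo2023

end
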